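import Literature.NumberTheory.LFunctions.DobnerSelbergClassSeriesProofs
import Literature.NumberTheory.LFunctions.DobnerLemma4Proofs
import HarnessLib

/-!
# Dobner's Lemma 4 (iii) (large `n`) for `F ∈ 𝒮♯` (proofs)

RH-FREE literature proofs (no new facts, no `def`s, no instances, no notation). Trunk T-ANT
(`Literature/NumberTheory/LFunctions`); node **L4a** of the plan of record for the discharge of
`Literature.NumberTheory.LFunctions.dobner_theorem2` (HOME/drafts/rt/t7-N1-PLAN.md §3 "File L4a";
rt-lead rulings (22)/(25)/(26), rt/STATUS 2026-08-26). Companion of `DobnerSelbergClassSteepest.lean`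
(the objects `Literature.NumberTheory.LFunctions.ExtendedSelbergDatum.dobnerJ`, `…dobnerI`,
`…dobnerB`), of `DobnerSelbergClassSeriesProofs.lean` (`γ` on vertical lines `Re z = σ > 0`:
`Literature.NumberTheory.LFunctions.ExtendedSelbergDatum.norm_gamma_vertical_le`,
`…differentiableAt_gamma_of_re_pos`, `…continuous_dobnerI_vertical`, imported — not restated) and
of the `ζ`-case files `DobnerLemma4Tools.lean` / `DobnerLemma4Proofs.lean`
(`Literature.NumberTheory.LFunctions.dobner_lemma4_large`), whose proof is ported here with
Dobner's general `γ(z) = α zᵐ (z−1)ᵐ Q^z ∏ Γ(ωᵢ z + μᵢ)` in place of `½ z(z−1) π^{−z/2} Γ(z/2)`.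

> A. Dobner, *A proof of Newman's conjecture for the extended Selberg class*, Acta Arith. 201
> (2021) = arXiv:2005.05142 (held; arXiv page numbers). **Lemma 4** (p. 10), third clause: "For
> `n > exp(y^{3/5}/|t|)`, `B_{t,n}(s) = O(exp(−(|t|/10) log² n))`" [for `t`, `s = x + iy`, `C` as in
> Thm. 4: `|x| ≤ C y^{1/4}`, `y` sufficiently large depending on `C`; the implicit constant may
> depend on `C`]. **Proof** (pp. 12–13): "(iii) is the large `n` case where `|t| log n > y^{3/5}`. We
> shift the vertical contour to the right from having real part `2` to having real part `σ`
> (to be chosen soon). Using Lemma 7 we get the upper bound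
> `B_{t,n}(s) ≪ ∫_{σ−i∞}^{σ+i∞} exp(K σ^{1.1} + (1/|t|) Re((J_t(s) − z)²) − σ log n) |dz|` …
> `≪ exp(K σ^{1.1} + (1/|t|)(Re J_t(s) − σ)² − σ log n)` … one may verify `Re J_t(s) ≪ y^{1/4}
> + |t| log y`, so from the assumption `|t| log n > y^{3/5}` we see that `|Re J_t(s)| ≤ 0.1 |t| log n`
> for large `y`. Upon choosing `σ ≔ Re J_t(s) + (|t|/2) log n`, … `B_{t,n}(s) ≪ exp(K(|t| log n)^{1.1}
> − 0.15|t| log² n)`. Now for large `y` we see that `|t| log n` will also be large, in which case the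
> second term dominates the first, so the above is `O(exp(−0.1|t| log² n))`." **Lemma 7** (p. 11):
> "There is some `K > 0` such that `|γ(z)| ≤ exp(K (Re z)^{1.1})` uniformly for any `z` with
> `Re z ≥ 1`."

## Main results (all `theorem`s; `D : ExtendedSelbergDatum`, `t < 0`)

* `ExtendedSelbergDatum.dobnerB_large` — **Lemma 4 (iii) for `𝒮♯`** in the shape of the third
  clause of the plan's `lemma4` (verbatim shape of the `ζ`-case named fact
  `Literature.NumberTheory.LFunctions.dobner_lemma4`, with `D.`): for `C > 0` there are `y₀, K > 0`
  with `‖B_{t,n}(s)‖ ≤ K e^{−(|t|/10) log² n}` whenever `|Re s| ≤ C (Im s)^{1/4}`, `Im s ≥ y₀`, `n ≥ 1`,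
  `log n > (Im s)^{3/5}/|t|` (here even `K = 1`);
* infrastructure for `𝓘` on vertical lines `Re z = σ > 0` (pole-free for `γ`; the `γ`-bound
  `‖γ(σ+iv)‖ ≤ ‖α‖ Q^σ (∏ᵢ Γ(ωᵢσ + Re μᵢ)) (σ+1+|v|)^{2m}` — the role of Lemma 7 — is
  `ExtendedSelbergDatum.norm_gamma_vertical_le` of `DobnerSelbergClassSeriesProofs.lean`):
  `gammaLineConst_pos`, `differentiableAt_dobnerI_of_re_pos`, `differentiableOn_dobnerI_strip`,
  `norm_dobnerI_vertical_le`, `integrable_dobnerI_vertical` (every `σ > 0`), `norm_dobnerI_strip_le`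
  (uniform Gaussian bound on `a ≤ Re z ≤ b`), and the line shift `integral_dobnerI_vertical_eq`
  (`∫ 𝓘(a+iv) dv = ∫ 𝓘(b+iv) dv`, `0 < a ≤ b`);
* the size of `J_t(s)`: `dobnerJ_im_mem` (`y ≤ Im J_t(s) ≤ y + (π|t|/2)∑ωᵢ` above the pole height)
  and `exists_abs_dobnerJ_re_sub_re_le` (`|Re J_t(s) − Re s| ≤ K₀ + K₁ log y`, the source's
  "`Re J_t(s) ≪ y^{1/4} + |t| log y`").

## Proof route (as printed, with the `ζ`-file's bookkeeping)

Shift `Re z = 2 → σ = Re J_t(s) + (|t|/2) log n` inside `{Re z > 0}` (Cauchy on rectangles,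
`MertensBoundRH.integral_vertical_eq_of_tendsto`; Gaussian decay on the horizontal edges); on the
new line `‖𝓘(σ+iv)‖ ≤ ‖α‖Q^σ(∏Γ(ωᵢσ+Re μᵢ)) e^{−0.15|t|log² n} (P+|v−Im J|)^{2m} e^{−(v−Im J)²/|t|}`,
the polynomial is absorbed into the Gaussian (`(P+|u|)^N e^{−u²/|t|} ≤ e^{NP+N²|t|/2}e^{−u²/(2|t|)}`),
and the prefactor `√2 ‖α‖ Q^σ ∏Γ(ωᵢσ + Re μᵢ) e^{NP + N²|t|/2}` is `exp(O(L log L + L^{5/3}))`,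
`L = |t| log n`, by `Γ(u) ≤ u^u` (`u ≥ 1`) — the content of Lemma 7 — hence `≤ e^{L log n/20}` for
`y` (and with it `L > y^{3/5}`) large. DIVERGENCE (proof-internal, as in the `ζ` file): Lemma 7's
`exp(Kσ^{1.1})` is replaced by the explicit `u^u` bound; `J_t` is the exact-cancellation variant of
`DobnerSelbergClassSteepest.lean` (module docstring there), immaterial here.

bears_on: N-C/N-P (COLUMN 3 DBN). WHAT THIS IS NOT: a tail estimate inside the re-proof of a
published RH-free theorem (`Λ_F ≥ 0` on `𝒮♯`); nothing here bears on the truth of RH.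
-/

noncomputable section

open Complex Filter Set MeasureTheory Topology

namespace Literature.NumberTheory.LFunctions

namespace ExtendedSelbergDatum

variable (D : ExtendedSelbergDatum)

/-! ### `γ` on the right half-plane and on vertical lines `Re z = σ > 0` -/

/-- The line constant `‖α‖ Q^σ ∏ Γ(ωᵢσ + Re μᵢ)` is positive. [cite: Dobner2021, Lemma 7, p. 11] -/
theorem gammaLineConst_pos {σ : ℝ} (hσ : 0 < σ) :
    0 < ‖D.alpha‖ * D.Q ^ σ * ∏ i, Real.Gamma (D.omega i * σ + (D.mu i).re) := by
  have hQpos : 0 < D.Q := D.Q_pos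
  have hα : 0 < ‖D.alpha‖ := norm_pos_iff.2 D.alpha_ne_zero
  refine mul_pos (mul_pos hα (Real.rpow_pos_of_pos hQpos σ)) (Finset.prod_pos fun i _ ↦ ?_)
  refine Real.Gamma_pos_of_pos ?_
  have := mul_pos (D.omega_pos i) hσ
  linarith [D.mu_re_nonneg i]

/-! ### The integrand `𝓘` on vertical lines in the right half-plane -/

/-- `𝓘` is differentiable at every `z` with `Re z > 0` (`n ≥ 1`). [cite: Dobner2021, Lemma 6 (definition of 𝓘), p. 11] -/
theorem differentiableAt_dobnerI_of_re_pos (t : ℝ) {n : ℕ} (hn : 1 ≤ n) (s : ℂ) {z : ℂ}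
    (hz : 0 < z.re) : DifferentiableAt ℂ (D.dobnerI t n s) z := by
  unfold dobnerI
  refine DifferentiableAt.mul (DifferentiableAt.mul (D.differentiableAt_gamma_of_re_pos hz) ?_) ?_
  · have hn0 : (n : ℂ) ≠ 0 := by exact_mod_cast (show n ≠ 0 by omega)
    exact differentiableAt_id.neg.const_cpow (Or.inl hn0)
  · exact DifferentiableAt.cexp (DifferentiableAt.const_mul
      (((differentiableAt_const _).sub differentiableAt_id).pow _) _)

/-- `𝓘` is holomorphic on every closed vertical strip `a ≤ Re z ≤ b` with `a > 0`. [cite: Dobner2021, proof of Lemma 4 (iii), p. 12] -/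
theorem differentiableOn_dobnerI_strip (t : ℝ) {n : ℕ} (hn : 1 ≤ n) (s : ℂ) {a b : ℝ} (ha : 0 < a) :
    DifferentiableOn ℂ (D.dobnerI t n s) (Icc a b ×ℂ univ) := fun _ hz ↦
  (D.differentiableAt_dobnerI_of_re_pos t hn s (ha.trans_le hz.1.1)).differentiableWithinAt

/-- **Bound on vertical lines in the right half-plane**:
`‖𝓘(σ + iv)‖ ≤ ‖α‖Q^σ(∏Γ(ωᵢσ + Re μᵢ)) (σ + 1 + |v|)^{2m} n^{−σ} e^{(Re J − σ)²/|t|} e^{−(Im J − v)²/|t|}`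
for `σ > 0`. [cite: Dobner2021, proof of Lemma 4 (iii), p. 12] -/
theorem norm_dobnerI_vertical_le (t : ℝ) {n : ℕ} (hn : 1 ≤ n) (s : ℂ) {σ : ℝ} (hσ : 0 < σ)
    (v : ℝ) :
    ‖D.dobnerI t n s (σ + v * I)‖ ≤
      (‖D.alpha‖ * D.Q ^ σ * ∏ i, Real.Gamma (D.omega i * σ + (D.mu i).re)) *
        (σ + 1 + |v|) ^ (2 * D.polarOrder) * (n : ℝ) ^ (-σ) *
        Real.exp (((D.dobnerJ t s).re - σ) ^ 2 / |t|) *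
        Real.exp (-(((D.dobnerJ t s).im - v) ^ 2 / |t|)) := by
  rw [D.norm_dobnerI t hn]
  have hγ := D.norm_gamma_vertical_le hσ v
  have hre : ((σ : ℂ) + v * I).re = σ := by simp
  have him : ((σ : ℂ) + v * I).im = v := by simp
  rw [hre, him, sub_div, Real.exp_sub, div_eq_mul_inv (Real.exp _), ← Real.exp_neg]
  have h0 : 0 ≤ (n : ℝ) ^ (-σ) := Real.rpow_nonneg n.cast_nonneg _
  calc ‖D.gamma (σ + v * I)‖ * (n : ℝ) ^ (-σ) *
        (Real.exp (((D.dobnerJ t s).re - σ) ^ 2 / |t|) *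
          Real.exp (-(((D.dobnerJ t s).im - v) ^ 2 / |t|)))
      ≤ (‖D.alpha‖ * D.Q ^ σ * ∏ i, Real.Gamma (D.omega i * σ + (D.mu i).re)) *
        (σ + 1 + |v|) ^ (2 * D.polarOrder) * (n : ℝ) ^ (-σ) *
        (Real.exp (((D.dobnerJ t s).re - σ) ^ 2 / |t|) *
          Real.exp (-(((D.dobnerJ t s).im - v) ^ 2 / |t|))) := by
        gcongr
    _ = _ := by ring

/-- Polynomial times Gaussian is below a wider Gaussian:
`(K + |u|)^N e^{−u²/b} ≤ e^{NK + N²b/2} e^{−u²/(2b)}` (`K ≥ 0`, `b > 0`), from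
`K + |u| ≤ e^{K + |u|}` and `N|u| ≤ u²/(2b) + N²b/2`. [folklore] -/
private theorem pow_mul_exp_neg_sq_le {K b : ℝ} (hK : 0 ≤ K) (hb : 0 < b) (N : ℕ) (u : ℝ) :
    (K + |u|) ^ N * Real.exp (-(u ^ 2 / b)) ≤
      Real.exp (N * K + N ^ 2 * b / 2) * Real.exp (-(u ^ 2 / (2 * b))) := by
  have hu : 0 ≤ |u| := abs_nonneg u
  have h1 : (K + |u|) ^ N ≤ Real.exp (N * (K + |u|)) := by
    calc (K + |u|) ^ N ≤ Real.exp (K + |u|) ^ N := by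
          refine pow_le_pow_left₀ (by positivity) ?_ N
          linarith [Real.add_one_le_exp (K + |u|)]
      _ = Real.exp (N * (K + |u|)) := by rw [← Real.exp_nat_mul]
  have h2 : (N : ℝ) * |u| ≤ u ^ 2 / (2 * b) + N ^ 2 * b / 2 := by
    have hsq : u ^ 2 = |u| ^ 2 := (sq_abs u).symm
    rw [hsq, div_add_div _ _ (by positivity) (by positivity), le_div_iff₀ (by positivity)]
    nlinarith [sq_nonneg (|u| - N * b), hb]
  calc (K + |u|) ^ N * Real.exp (-(u ^ 2 / b))
      ≤ Real.exp (N * (K + |u|)) * Real.exp (-(u ^ 2 / b)) :=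
        mul_le_mul_of_nonneg_right h1 (Real.exp_pos _).le
    _ = Real.exp (N * (K + |u|) - u ^ 2 / b) := by rw [← Real.exp_add]; ring_nf
    _ ≤ Real.exp (N * K + N ^ 2 * b / 2 + -(u ^ 2 / (2 * b))) := by
        refine Real.exp_le_exp.2 ?_
        have e : u ^ 2 / b = u ^ 2 / (2 * b) + u ^ 2 / (2 * b) := by field_simp; ring
        rw [e]
        linarith
    _ = _ := by rw [Real.exp_add]

/-- **`v ↦ 𝓘(σ + iv)` is integrable** for `σ > 0` (`n ≥ 1`, `t ≠ 0`): the polynomial-times-Gaussian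
majorant is below a Gaussian. [cite: Dobner2021, proof of Lemma 4 (iii), p. 12] -/
theorem integrable_dobnerI_vertical {t : ℝ} (ht : t ≠ 0) {n : ℕ} (hn : 1 ≤ n) (s : ℂ) {σ : ℝ}
    (hσ : 0 < σ) : Integrable fun v : ℝ ↦ D.dobnerI t n s (σ + v * I) := by
  have ht' : 0 < |t| := abs_pos.2 ht
  set J := D.dobnerJ t s with hJ
  set N : ℕ := 2 * D.polarOrder with hN
  set Cγ : ℝ := ‖D.alpha‖ * D.Q ^ σ * ∏ i, Real.Gamma (D.omega i * σ + (D.mu i).re) with hCγ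
  have hCγ0 : 0 ≤ Cγ := (D.gammaLineConst_pos hσ).le
  set P : ℝ := σ + 1 + |J.im| with hP
  have hP0 : 0 ≤ P := by positivity
  set M : ℝ := Cγ * (n : ℝ) ^ (-σ) * Real.exp ((J.re - σ) ^ 2 / |t|) *
    Real.exp (N * P + N ^ 2 * |t| / 2) with hM
  have hM0 : 0 ≤ M := by
    have : 0 ≤ (n : ℝ) ^ (-σ) := Real.rpow_nonneg n.cast_nonneg _
    positivity
  have hg := (integrable_exp_neg_sq_sub_div J.im ht').const_mul M
  refine hg.mono' (D.continuous_dobnerI_vertical t n s hσ).aestronglyMeasurable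
    (Eventually.of_forall fun v ↦ ?_)
  have h1 := D.norm_dobnerI_vertical_le t hn s hσ v
  rw [← hJ] at h1
  have h2 : (σ + 1 + |v|) ^ N ≤ (P + |v - J.im|) ^ N := by
    refine pow_le_pow_left₀ (by positivity) ?_ N
    rw [hP]
    linarith [abs_sub_abs_le_abs_sub v J.im]
  have h3 := pow_mul_exp_neg_sq_le hP0 ht' N (v - J.im)
  have e1 : (J.im - v) ^ 2 = (v - J.im) ^ 2 := by ring
  calc ‖D.dobnerI t n s (σ + v * I)‖
      ≤ Cγ * (σ + 1 + |v|) ^ N * (n : ℝ) ^ (-σ) * Real.exp ((J.re - σ) ^ 2 / |t|) *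
          Real.exp (-((J.im - v) ^ 2 / |t|)) := h1
    _ = Cγ * (n : ℝ) ^ (-σ) * Real.exp ((J.re - σ) ^ 2 / |t|) *
          ((σ + 1 + |v|) ^ N * Real.exp (-((v - J.im) ^ 2 / |t|))) := by rw [e1]; ring
    _ ≤ Cγ * (n : ℝ) ^ (-σ) * Real.exp ((J.re - σ) ^ 2 / |t|) *
          ((P + |v - J.im|) ^ N * Real.exp (-((v - J.im) ^ 2 / |t|))) := by gcongr
    _ ≤ Cγ * (n : ℝ) ^ (-σ) * Real.exp ((J.re - σ) ^ 2 / |t|) *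
          (Real.exp (N * P + N ^ 2 * |t| / 2) * Real.exp (-((v - J.im) ^ 2 / (2 * |t|)))) := by
        gcongr
    _ = M * Real.exp (-((v - J.im) ^ 2 / (2 * |t|))) := by rw [hM]; ring

/-- `Γ(u) ≤ max(Γ(p), Γ(q))` for `u ∈ [p, q]`, `p > 0` (convexity of `Γ`). [folklore] -/
private theorem real_Gamma_le_max_of_mem_Icc {p q u : ℝ} (hp : 0 < p) (hu : u ∈ Set.Icc p q) :
    Real.Gamma u ≤ max (Real.Gamma p) (Real.Gamma q) := by
  have hpq : p ≤ q := hu.1.trans hu.2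
  have hseg : u ∈ segment ℝ p q := by rw [segment_eq_Icc hpq]; exact hu
  exact Real.convexOn_Gamma.le_on_segment (show p ∈ Set.Ioi (0 : ℝ) from hp)
    (show q ∈ Set.Ioi (0 : ℝ) from hp.trans_le hpq) hseg

/-- **Uniform bound on a vertical strip `Re z ∈ [a, b] ⊂ (0, ∞)`**: there is `M ≥ 0` (depending on
`D, t, s, a, b`, not on `n ≥ 1`) with `‖𝓘(σ + iT)‖ ≤ M e^{−T²/(4|t|)}` for all `σ ∈ [a, b]`, `T`.
[cite: Dobner2021, proof of Lemma 4 (iii), p. 12] -/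
theorem norm_dobnerI_strip_le {t : ℝ} (ht : t ≠ 0) (s : ℂ) {a b : ℝ} (ha : 0 < a) (hab : a ≤ b) :
    ∃ M : ℝ, 0 ≤ M ∧ ∀ n : ℕ, 1 ≤ n → ∀ σ ∈ Set.Icc a b, ∀ T : ℝ,
      ‖D.dobnerI t n s (σ + T * I)‖ ≤ M * Real.exp (-(T ^ 2 / (4 * |t|))) := by
  have ht' : 0 < |t| := abs_pos.2 ht
  set J := D.dobnerJ t s with hJ
  set N : ℕ := 2 * D.polarOrder with hN
  -- uniform constants on the strip
  set Qab : ℝ := Real.exp (b * |Real.log D.Q|) with hQab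
  set Gab : ℝ := ∏ i, max (Real.Gamma (D.omega i * a + (D.mu i).re))
    (Real.Gamma (D.omega i * b + (D.mu i).re)) with hGab
  have hGab0 : 0 ≤ Gab := Finset.prod_nonneg fun i _ ↦
    le_max_of_le_left (Real.Gamma_pos_of_pos (by
      have := mul_pos (D.omega_pos i) ha; linarith [D.mu_re_nonneg i])).le
  have hb : 0 < b := ha.trans_le hab
  set P : ℝ := b + 1 + |J.im| with hP
  have hP0 : 0 ≤ P := by positivity
  set M : ℝ := ‖D.alpha‖ * Qab * Gab * Real.exp ((|J.re| + b) ^ 2 / |t|) *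
    Real.exp (J.im ^ 2 / |t|) * Real.exp (N * P + N ^ 2 * (2 * |t|) / 2) with hM
  have hM0 : 0 ≤ M := by rw [hM]; positivity
  refine ⟨M, hM0, fun n hn σ hσ T ↦ ?_⟩
  have hσ0 : 0 < σ := ha.trans_le hσ.1
  have hΓσ0 : 0 ≤ ∏ i, Real.Gamma (D.omega i * σ + (D.mu i).re) :=
    Finset.prod_nonneg fun i _ ↦ (Real.Gamma_pos_of_pos (by
      have := mul_pos (D.omega_pos i) hσ0; linarith [D.mu_re_nonneg i])).le
  have h1 := D.norm_dobnerI_vertical_le t hn s hσ0 T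
  rw [← hJ] at h1
  have hQpos : 0 < D.Q := D.Q_pos
  -- the individual factors
  have f1 : D.Q ^ σ ≤ Qab := by
    rw [Real.rpow_def_of_pos hQpos, hQab, Real.exp_le_exp]
    calc Real.log D.Q * σ ≤ |Real.log D.Q| * σ := by
          exact mul_le_mul_of_nonneg_right (le_abs_self _) hσ0.le
      _ ≤ |Real.log D.Q| * b := mul_le_mul_of_nonneg_left hσ.2 (abs_nonneg _)
      _ = b * |Real.log D.Q| := mul_comm _ _
  have f2 : ∏ i, Real.Gamma (D.omega i * σ + (D.mu i).re) ≤ Gab := by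
    refine Finset.prod_le_prod (fun i _ ↦ (Real.Gamma_pos_of_pos ?_).le) fun i _ ↦ ?_
    · have := mul_pos (D.omega_pos i) hσ0; linarith [D.mu_re_nonneg i]
    · refine real_Gamma_le_max_of_mem_Icc ?_ ⟨?_, ?_⟩
      · have := mul_pos (D.omega_pos i) ha; linarith [D.mu_re_nonneg i]
      · have := mul_le_mul_of_nonneg_left hσ.1 (D.omega_pos i).le; linarith
      · have := mul_le_mul_of_nonneg_left hσ.2 (D.omega_pos i).le; linarith
  have f3 : (σ + 1 + |T|) ^ N ≤ (P + |T|) ^ N := by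
    refine pow_le_pow_left₀ (by positivity) ?_ N
    rw [hP]; linarith [hσ.2, abs_nonneg J.im]
  have f4 : (n : ℝ) ^ (-σ) ≤ 1 :=
    Real.rpow_le_one_of_one_le_of_nonpos (by exact_mod_cast hn) (by linarith)
  have f5 : Real.exp ((J.re - σ) ^ 2 / |t|) ≤ Real.exp ((|J.re| + b) ^ 2 / |t|) := by
    refine Real.exp_le_exp.2 (div_le_div_of_nonneg_right ?_ ht'.le)
    have : |J.re - σ| ≤ |J.re| + b := by
      calc |J.re - σ| ≤ |J.re| + |σ| := abs_sub _ _
        _ ≤ |J.re| + b := by rw [abs_of_pos hσ0]; linarith [hσ.2]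
    calc (J.re - σ) ^ 2 = |J.re - σ| ^ 2 := (sq_abs _).symm
      _ ≤ (|J.re| + b) ^ 2 := pow_le_pow_left₀ (abs_nonneg _) this 2
  have f6 : Real.exp (-((J.im - T) ^ 2 / |t|)) ≤
      Real.exp (J.im ^ 2 / |t|) * Real.exp (-(T ^ 2 / (2 * |t|))) := by
    rw [← Real.exp_add, Real.exp_le_exp]
    have : T ^ 2 / 2 - J.im ^ 2 ≤ (J.im - T) ^ 2 := by nlinarith [sq_nonneg (J.im - T / 2)]
    have e1 : J.im ^ 2 / |t| + -(T ^ 2 / (2 * |t|)) = (J.im ^ 2 - T ^ 2 / 2) / |t| := by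
      field_simp; ring
    have e2 : -((J.im - T) ^ 2 / |t|) = (-(J.im - T) ^ 2) / |t| := by ring
    rw [e1, e2]
    exact div_le_div_of_nonneg_right (by linarith) ht'.le
  have f7 := pow_mul_exp_neg_sq_le hP0 (show 0 < 2 * |t| by positivity) N T
  have e7 : -(T ^ 2 / (2 * (2 * |t|))) = -(T ^ 2 / (4 * |t|)) := by ring_nf
  rw [e7] at f7
  have hα0 : 0 ≤ ‖D.alpha‖ := norm_nonneg _
  calc ‖D.dobnerI t n s (σ + T * I)‖
      ≤ (‖D.alpha‖ * D.Q ^ σ * ∏ i, Real.Gamma (D.omega i * σ + (D.mu i).re)) *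
          (σ + 1 + |T|) ^ N * (n : ℝ) ^ (-σ) * Real.exp ((J.re - σ) ^ 2 / |t|) *
          Real.exp (-((J.im - T) ^ 2 / |t|)) := h1
    _ ≤ (‖D.alpha‖ * Qab * Gab) * (P + |T|) ^ N * 1 * Real.exp ((|J.re| + b) ^ 2 / |t|) *
          (Real.exp (J.im ^ 2 / |t|) * Real.exp (-(T ^ 2 / (2 * |t|)))) := by
        gcongr
    _ = ‖D.alpha‖ * Qab * Gab * Real.exp ((|J.re| + b) ^ 2 / |t|) * Real.exp (J.im ^ 2 / |t|) *
          ((P + |T|) ^ N * Real.exp (-(T ^ 2 / (2 * |t|)))) := by ring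
    _ ≤ ‖D.alpha‖ * Qab * Gab * Real.exp ((|J.re| + b) ^ 2 / |t|) * Real.exp (J.im ^ 2 / |t|) *
          (Real.exp (N * P + N ^ 2 * (2 * |t|) / 2) * Real.exp (-(T ^ 2 / (4 * |t|)))) := by
        gcongr
    _ = M * Real.exp (-(T ^ 2 / (4 * |t|))) := by rw [hM]; ring

/-- **Shifting the line of integration inside `Re z > 0`**: for `0 < a ≤ b`,
`∫ 𝓘(a + iv) dv = ∫ 𝓘(b + iv) dv` (Cauchy's theorem on rectangles; `𝓘` is holomorphic on
`Re z > 0` — no pole of `γ` lies there — and decays like a Gaussian at the ends of the strip).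
[cite: Dobner2021, proof of Lemma 4 (iii), p. 12 ("We shift the vertical contour to the right")] -/
theorem integral_dobnerI_vertical_eq {t : ℝ} (ht : t ≠ 0) {n : ℕ} (hn : 1 ≤ n) (s : ℂ) {a b : ℝ}
    (ha : 0 < a) (hab : a ≤ b) :
    ∫ v : ℝ, D.dobnerI t n s (a + v * I) = ∫ v : ℝ, D.dobnerI t n s (b + v * I) := by
  have ht' : 0 < |t| := abs_pos.2 ht
  obtain ⟨M, hM0, hM⟩ := D.norm_dobnerI_strip_le ht s ha hab
  refine MertensBoundRH.integral_vertical_eq_of_tendsto (D.dobnerI t n s) hab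
    (D.differentiableOn_dobnerI_strip t hn s ha)
    (D.integrable_dobnerI_vertical ht hn s ha) (D.integrable_dobnerI_vertical ht hn s (ha.trans_le hab))
    fun ε hε ↦ ?_
  have hlim : Tendsto (fun R : ℝ ↦ M * Real.exp (-(R ^ 2 / (4 * |t|)))) atTop (𝓝 0) := by
    have h1 : Tendsto (fun R : ℝ ↦ -(R ^ 2 / (4 * |t|))) atTop atBot := by
      have : Tendsto (fun R : ℝ ↦ R ^ 2 / (4 * |t|)) atTop atTop :=
        (tendsto_pow_atTop two_ne_zero).atTop_div_const (by positivity)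
      exact tendsto_neg_atTop_atBot.comp this
    simpa using (Real.tendsto_exp_atBot.comp h1).const_mul M
  obtain ⟨R₀, hR₀⟩ := eventually_atTop.1 (hlim.eventually (gt_mem_nhds hε))
  refine ⟨max R₀ 0, fun σ hσ T hT ↦ ?_⟩
  have hT' : R₀ ≤ |T| := (le_max_left _ _).trans hT
  calc ‖D.dobnerI t n s (σ + T * I)‖ ≤ M * Real.exp (-(T ^ 2 / (4 * |t|))) := hM n hn σ hσ T
    _ = M * Real.exp (-(|T| ^ 2 / (4 * |t|))) := by rw [sq_abs]
    _ ≤ ε := (hR₀ |T| hT').le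

/-! ### The size of `J_t(s)` -/

/-- Above the pole height: `y ≤ Im J_t(s) ≤ y + (π|t|/2) ∑ωᵢ` (each `arg(ωᵢ s + μᵢ) ∈ [0, π]`).
[cite: Dobner2021, proof of Lemma 4, p. 12] -/
theorem dobnerJ_im_mem (t : ℝ) {s : ℂ} (hs : D.poleHeight < s.im) :
    s.im ≤ (D.dobnerJ t s).im ∧ (D.dobnerJ t s).im ≤ s.im + Real.pi * |t| / 2 * D.omegaSum := by
  rw [D.dobnerJ_im]
  have h0 : ∀ i, 0 ≤ D.omega i * Complex.arg ((D.omega i : ℂ) * s + D.mu i) := fun i ↦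
    mul_nonneg (D.omega_pos i).le (Complex.arg_nonneg_iff.2 (D.im_omega_mul_add_mu_pos i hs).le)
  have h1 : ∀ i, D.omega i * Complex.arg ((D.omega i : ℂ) * s + D.mu i) ≤ D.omega i * Real.pi :=
    fun i ↦ mul_le_mul_of_nonneg_left (Complex.arg_le_pi _) (D.omega_pos i).le
  have hsum0 : 0 ≤ ∑ i, D.omega i * Complex.arg ((D.omega i : ℂ) * s + D.mu i) :=
    Finset.sum_nonneg fun i _ ↦ h0 i
  have hsum1 : ∑ i, D.omega i * Complex.arg ((D.omega i : ℂ) * s + D.mu i) ≤ Real.pi * D.omegaSum := by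
    calc ∑ i, D.omega i * Complex.arg ((D.omega i : ℂ) * s + D.mu i) ≤ ∑ i, D.omega i * Real.pi :=
          Finset.sum_le_sum fun i _ ↦ h1 i
      _ = Real.pi * D.omegaSum := by rw [omegaSum, Finset.mul_sum]; simp_rw [mul_comm]
  have ht : 0 ≤ |t| / 2 := by positivity
  constructor
  · nlinarith
  · have := mul_le_mul_of_nonneg_left hsum1 ht
    nlinarith

/-- **"`Re J_t(s) ≪ y^{1/4} + |t| log y`"** (p. 12), in the form used: there are `K₀, K₁ ≥ 0`
(depending on `D, t`) with `|Re J_t(s) − Re s| ≤ K₀ + K₁ log y` whenever `y = Im s ≥ max(1, 2P)`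
and `|Re s| ≤ y` (`P` the pole height): each `|ωᵢ s + μᵢ|` lies in `[ωᵢ y/2, (2ωᵢ + |μᵢ|) y]`.
[cite: Dobner2021, proof of Lemma 4 (iii), p. 12] -/
theorem exists_abs_dobnerJ_re_sub_re_le (t : ℝ) : ∃ K₀ K₁ : ℝ, 0 ≤ K₀ ∧ 0 ≤ K₁ ∧ ∀ s : ℂ,
    1 ≤ s.im → 2 * D.poleHeight ≤ s.im → |s.re| ≤ s.im →
      |(D.dobnerJ t s).re - s.re| ≤ K₀ + K₁ * Real.log s.im := by
  set c : Fin D.numGamma → ℝ := fun i ↦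
    |Real.log (2 * D.omega i + ‖D.mu i‖)| + |Real.log (D.omega i / 2)| with hc
  have hc0 : ∀ i, 0 ≤ c i := fun i ↦ by positivity
  refine ⟨|t| / 2 * (|Real.log D.Q| + ∑ i, D.omega i * c i), |t| / 2 * D.omegaSum,
    by
      have : 0 ≤ ∑ i, D.omega i * c i := Finset.sum_nonneg fun i _ ↦ mul_nonneg (D.omega_pos i).le (hc0 i)
      positivity,
    mul_nonneg (by positivity) D.omegaSum_nonneg, fun s hy1 hyP hx ↦ ?_⟩
  have hy0 : 0 < s.im := by linarith
  have hlog0 : 0 ≤ Real.log s.im := Real.log_nonneg hy1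
  rw [D.dobnerJ_re, add_sub_cancel_left, abs_mul, abs_of_nonneg (by positivity : 0 ≤ |t| / 2)]
  have hns : ‖s‖ ≤ 2 * s.im := by
    calc ‖s‖ ≤ |s.re| + |s.im| := Complex.norm_le_abs_re_add_abs_im s
      _ ≤ s.im + s.im := by rw [abs_of_pos hy0]; linarith
      _ = 2 * s.im := by ring
  -- per-factor bound `|log‖ωᵢ s + μᵢ‖| ≤ log y + cᵢ`
  have hi : ∀ i, |Real.log ‖(D.omega i : ℂ) * s + D.mu i‖| ≤ Real.log s.im + c i := by
    intro i
    have hω := D.omega_pos i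
    have hlow : D.omega i * s.im / 2 ≤ ‖(D.omega i : ℂ) * s + D.mu i‖ := D.norm_omega_mul_add_mu_ge i hyP
    have hlow0 : 0 < D.omega i * s.im / 2 := by positivity
    have hw0 : 0 < ‖(D.omega i : ℂ) * s + D.mu i‖ := hlow0.trans_le hlow
    have hup : ‖(D.omega i : ℂ) * s + D.mu i‖ ≤ (2 * D.omega i + ‖D.mu i‖) * s.im := by
      calc ‖(D.omega i : ℂ) * s + D.mu i‖ ≤ ‖(D.omega i : ℂ) * s‖ + ‖D.mu i‖ := norm_add_le _ _
        _ = D.omega i * ‖s‖ + ‖D.mu i‖ := by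
            rw [norm_mul, Complex.norm_real, Real.norm_eq_abs, abs_of_pos hω]
        _ ≤ D.omega i * (2 * s.im) + ‖D.mu i‖ * s.im := by
            have := mul_le_mul_of_nonneg_left hns hω.le
            have h2 : ‖D.mu i‖ * 1 ≤ ‖D.mu i‖ * s.im := mul_le_mul_of_nonneg_left hy1 (norm_nonneg _)
            linarith
        _ = (2 * D.omega i + ‖D.mu i‖) * s.im := by ring
    have hup' : Real.log ‖(D.omega i : ℂ) * s + D.mu i‖ ≤
        Real.log (2 * D.omega i + ‖D.mu i‖) + Real.log s.im := by
      rw [← Real.log_mul (by positivity) hy0.ne']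
      exact Real.log_le_log hw0 hup
    have hlow' : Real.log (D.omega i / 2) + Real.log s.im ≤
        Real.log ‖(D.omega i : ℂ) * s + D.mu i‖ := by
      rw [← Real.log_mul (by positivity) hy0.ne']
      refine Real.log_le_log (by positivity) ?_
      calc D.omega i / 2 * s.im = D.omega i * s.im / 2 := by ring
        _ ≤ _ := hlow
    rw [abs_le]
    constructor
    · have : -|Real.log (D.omega i / 2)| ≤ Real.log (D.omega i / 2) := neg_abs_le _
      simp only [hc]
      linarith [abs_nonneg (Real.log (2 * D.omega i + ‖D.mu i‖))]
    · have : Real.log (2 * D.omega i + ‖D.mu i‖) ≤ |Real.log (2 * D.omega i + ‖D.mu i‖)| := le_abs_self _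
      simp only [hc]
      linarith [abs_nonneg (Real.log (D.omega i / 2))]
  have hsum : |Real.log D.Q + ∑ i, D.omega i * Real.log ‖(D.omega i : ℂ) * s + D.mu i‖| ≤
      |Real.log D.Q| + ∑ i, D.omega i * c i + D.omegaSum * Real.log s.im := by
    calc |Real.log D.Q + ∑ i, D.omega i * Real.log ‖(D.omega i : ℂ) * s + D.mu i‖|
        ≤ |Real.log D.Q| + |∑ i, D.omega i * Real.log ‖(D.omega i : ℂ) * s + D.mu i‖| := abs_add_le _ _
      _ ≤ |Real.log D.Q| + ∑ i, |D.omega i * Real.log ‖(D.omega i : ℂ) * s + D.mu i‖| := by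
          gcongr; exact Finset.abs_sum_le_sum_abs _ _
      _ ≤ |Real.log D.Q| + ∑ i, D.omega i * (Real.log s.im + c i) := by
          gcongr with i _
          rw [abs_mul, abs_of_pos (D.omega_pos i)]
          exact mul_le_mul_of_nonneg_left (hi i) (D.omega_pos i).le
      _ = |Real.log D.Q| + ∑ i, D.omega i * c i + D.omegaSum * Real.log s.im := by
          rw [omegaSum, Finset.sum_mul, add_assoc, ← Finset.sum_add_distrib]
          congr 1
          refine Finset.sum_congr rfl fun i _ ↦ ?_
          ring
  calc |t| / 2 * |Real.log D.Q + ∑ i, D.omega i * Real.log ‖(D.omega i : ℂ) * s + D.mu i‖|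
      ≤ |t| / 2 * (|Real.log D.Q| + ∑ i, D.omega i * c i + D.omegaSum * Real.log s.im) :=
        mul_le_mul_of_nonneg_left hsum (by positivity)
    _ = _ := by ring


/-! ### Lemma 4 (iii): large `n` -/

set_option maxHeartbeats 800000 in
/-- **Dobner's Lemma 4 (iii) for `F ∈ 𝒮♯`** (large `n`): for `t < 0` and `C > 0` there are `y₀` and
`K > 0` such that for `|Re s| ≤ C (Im s)^{1/4}`, `Im s ≥ y₀`, `n ≥ 1` with `log n > (Im s)^{3/5}/|t|`:
`‖B_{t,n}(s)‖ ≤ K e^{−(|t|/10) log² n}` (third clause of the plan's `lemma4`; here `K = 1`).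
Proof as printed (pp. 12–13): shift the line `Re z = 2` to `Re z = σ := Re J_t(s) + (|t|/2) log n`,
bound `γ` on that line (Lemma 7's role: `norm_gamma_vertical_le` and `Γ(u) ≤ u^u`), and absorb
`exp(O(L log L + L^{5/3}))`, `L = |t| log n > y^{3/5}`, into `e^{−0.05 |t| log² n}`.
[cite: Dobner2021, Lemma 4 (iii), p. 10; proof pp. 12–13] -/
theorem dobnerB_large {t : ℝ} (ht : t < 0) (C : ℝ) :
    ∃ y₀ K : ℝ, 0 < K ∧ ∀ s : ℂ, |s.re| ≤ C * s.im ^ (1 / 4 : ℝ) → y₀ ≤ s.im → ∀ n : ℕ, 1 ≤ n →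
      s.im ^ (3 / 5 : ℝ) / |t| < Real.log n →
        ‖D.dobnerB t n s‖ ≤ K * Real.exp (-(|t| / 10) * Real.log n ^ 2) := by
  have ht0 : t ≠ 0 := ht.ne
  have hτ : 0 < |t| := abs_pos.2 ht0
  set τ : ℝ := |t| with hτdef
  have hpi := Real.pi_gt_three
  have hpi4 := Real.pi_le_four
  -- the data-dependent constants
  set N : ℕ := 2 * D.polarOrder with hNdef
  set W : ℝ := D.omegaSum with hWdef
  have hW0 : 0 ≤ W := D.omegaSum_nonneg
  set k : ℕ := D.numGamma with hkdef
  set cα : ℝ := Real.sqrt 2 * ‖D.alpha‖ with hcαdef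
  have hcα0 : 0 ≤ cα := by positivity
  set lQ : ℝ := |Real.log D.Q| with hlQdef
  have hlQ0 : 0 ≤ lQ := abs_nonneg _
  set cω : ℝ := ∑ i, 1 / D.omega i with hcωdef
  have hcω0 : 0 ≤ cω := Finset.sum_nonneg fun i _ ↦ (one_div_pos.2 (D.omega_pos i)).le
  set Mμ : ℝ := ∑ i, (D.mu i).re with hMμdef
  have hMμ0 : 0 ≤ Mμ := Finset.sum_nonneg fun i _ ↦ D.mu_re_nonneg i
  set cR : ℝ := W + Mμ + 1 with hcRdef
  have hcR1 : 1 ≤ cR := by rw [hcRdef]; linarith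
  have hlogcR : 0 ≤ Real.log cR := Real.log_nonneg hcR1
  obtain ⟨K₀, K₁, hK₀, hK₁, hJre⟩ := D.exists_abs_dobnerJ_re_sub_re_le t
  -- Step 0: conditions on `L = |t| log n`
  set c₀ : ℝ := cα + N * (1 + 2 * τ * W) + N ^ 2 * τ / 2 with hc₀def
  set c₁ : ℝ := lQ + 3 * N / 5 + k * cR * Real.log cR with hc₁def
  have hevL : ∀ᶠ L : ℝ in atTop, 10 ≤ L ∧ 5 / 2 * cω ≤ L ∧
      100 * τ * c₀ ≤ L ^ (2 : ℝ) ∧ 100 * τ * c₁ * L ^ (1 : ℝ) ≤ L ^ (2 : ℝ) ∧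
      100 * τ * (k * cR) * L ^ (1 : ℝ) * Real.log L ≤ L ^ (2 : ℝ) ∧
      100 * τ * N * L ^ (5 / 3 : ℝ) ≤ L ^ (2 : ℝ) := by
    filter_upwards [eventually_ge_atTop (10 : ℝ), eventually_ge_atTop (5 / 2 * cω),
      eventually_const_le_rpow (100 * τ * c₀) (by norm_num : (0 : ℝ) < 2),
      eventually_const_mul_rpow_le_rpow (100 * τ * c₁) (by norm_num : (1 : ℝ) < 2),
      eventually_const_mul_rpow_mul_log_le_rpow (100 * τ * (k * cR)) (by norm_num : (1 : ℝ) < 2),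
      eventually_const_mul_rpow_le_rpow (100 * τ * N) (by norm_num : (5 / 3 : ℝ) < 2)]
      with L h1 h2 h3 h4 h5 h6
    exact ⟨h1, h2, h3, h4, h5, h6⟩
  obtain ⟨L₀, hL₀⟩ := eventually_atTop.1 hevL
  -- Step 1: conditions on `y = Im s`
  have hevy : ∀ᶠ y : ℝ in atTop, 1 ≤ y ∧ 2 * D.poleHeight + 1 ≤ y ∧ C * y ^ (1 / 4 : ℝ) ≤ y ∧
      10 * (C * y ^ (1 / 4 : ℝ) + K₀ + K₁ * Real.log y) ≤ y ^ (3 / 5 : ℝ) ∧ L₀ ≤ y ^ (3 / 5 : ℝ) := by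
    have e2 := eventually_const_mul_rpow_le_rpow C (by norm_num : (1 / 4 : ℝ) < 1)
    have e3 := eventually_const_mul_rpow_le_rpow (30 * C) (by norm_num : (1 / 4 : ℝ) < 3 / 5)
    have e4 := eventually_const_le_rpow (30 * K₀) (by norm_num : (0 : ℝ) < 3 / 5)
    have e5 := eventually_const_mul_log_le_rpow (30 * K₁) (by norm_num : (0 : ℝ) < 3 / 5)
    have e6 := eventually_const_le_rpow L₀ (by norm_num : (0 : ℝ) < 3 / 5)
    filter_upwards [eventually_ge_atTop (1 : ℝ), eventually_ge_atTop (2 * D.poleHeight + 1), e2, e3,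
      e4, e5, e6] with y h1 h1' h2 h3 h4 h5 h6
    rw [Real.rpow_one] at h2
    exact ⟨h1, h1', h2, by linarith, h6⟩
  obtain ⟨y₀, hy₀⟩ := eventually_atTop.1 hevy
  refine ⟨y₀, 1, one_pos, fun s hx hy n hn hℓ ↦ ?_⟩
  obtain ⟨hy1, hyP, hxy, hReJ0, hL0y⟩ := hy₀ s.im hy
  -- Step 2: notation and basic sizes
  set y : ℝ := s.im with hydef
  set x : ℝ := s.re with hxdef
  set ℓ : ℝ := Real.log n with hℓdef
  set L : ℝ := τ * ℓ with hLdef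
  set J : ℂ := D.dobnerJ t s with hJdef
  have hy0 : 0 < y := by linarith
  have hPh : D.poleHeight < y := by linarith [D.poleHeight_nonneg]
  have h2Ph : 2 * D.poleHeight ≤ y := by linarith [D.poleHeight_nonneg]
  have hℓ0 : 0 ≤ ℓ := Real.log_natCast_nonneg n
  have hyL : y ^ (3 / 5 : ℝ) < L := by
    rw [hLdef]; rwa [div_lt_iff₀ hτ, mul_comm] at hℓ
  have hL0 : L₀ ≤ L := hL0y.trans hyL.le
  obtain ⟨hL10, hLcω, hA1, hA2, hA3, hA4⟩ := hL₀ L hL0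
  rw [Real.rpow_one] at hA2 hA3
  have hL1 : 1 ≤ L := by linarith
  have hLpos : 0 < L := by linarith
  have hℓpos : 0 < ℓ := by
    rw [hLdef] at hLpos; exact pos_of_mul_pos_right hLpos hτ.le
  have hL2 : L ^ (2 : ℝ) = L * L := by
    rw [show (2 : ℝ) = ((2 : ℕ) : ℝ) by norm_num, Real.rpow_natCast, sq]
  -- `|Re J| ≤ L/10`
  have hxabs : |x| ≤ y := hx.trans hxy
  have hJre' : |J.re| ≤ y ^ (3 / 5 : ℝ) / 10 := by
    have h1 := hJre s hy1 h2Ph hxabs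
    rw [← hJdef, ← hxdef, ← hydef] at h1
    have : |J.re| ≤ |J.re - x| + |x| := by
      calc |J.re| = |(J.re - x) + x| := by ring_nf
        _ ≤ |J.re - x| + |x| := abs_add_le _ _
    linarith
  have hJre : |J.re| ≤ L / 10 := by linarith
  -- `Im J ∈ [y, y + 2τW]`
  have hJim := D.dobnerJ_im_mem t (s := s) hPh
  rw [← hJdef, ← hydef] at hJim
  have hJim1 : 0 < J.im := by linarith [hJim.1]
  have hJim2 : J.im ≤ y + 2 * τ * W := by
    have h : Real.pi * |t| / 2 * D.omegaSum ≤ 2 * τ * W := by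
      rw [← hτdef, ← hWdef]
      have h0 : 0 ≤ τ * W := mul_nonneg hτ.le hW0
      calc Real.pi * τ / 2 * W = Real.pi * (τ * W) / 2 := by ring
        _ ≤ 4 * (τ * W) / 2 := by gcongr
        _ = 2 * τ * W := by ring
    linarith [hJim.2]
  -- `y ≤ L^{5/3}`
  have hyL' : y ≤ L ^ (5 / 3 : ℝ) := by
    have h1 : (y ^ (3 / 5 : ℝ)) ^ (5 / 3 : ℝ) ≤ L ^ (5 / 3 : ℝ) :=
      Real.rpow_le_rpow (Real.rpow_nonneg hy0.le _) hyL.le (by norm_num)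
    rwa [← Real.rpow_mul hy0.le, show (3 / 5 : ℝ) * (5 / 3) = 1 by norm_num, Real.rpow_one] at h1
  -- Step 3: the abscissa `σ = Re J + L/2` and the line shift
  set σ : ℝ := J.re + L / 2 with hσdef
  have hσ1 : 2 * L / 5 ≤ σ := by linarith [neg_abs_le J.re, (abs_le.1 hJre).1]
  have hσ2 : σ ≤ 3 * L / 5 := by linarith [(abs_le.1 hJre).2]
  have hσL : σ ≤ L := by linarith
  have hσ4 : 4 ≤ σ := by linarith
  have hσ0 : 0 < σ := by linarith
  have hshift : ∫ v : ℝ, D.dobnerI t n s (2 + v * I) = ∫ v : ℝ, D.dobnerI t n s (σ + v * I) := by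
    simpa using D.integral_dobnerI_vertical_eq ht0 hn s (by norm_num : (0 : ℝ) < 2)
      (by linarith : (2 : ℝ) ≤ σ)
  -- Step 4: pointwise bound on the new line and integration
  set Cσ : ℝ := ‖D.alpha‖ * D.Q ^ σ * ∏ i, Real.Gamma (D.omega i * σ + (D.mu i).re) with hCσdef
  have hCσ0 : 0 < Cσ := D.gammaLineConst_pos hσ0
  set P : ℝ := σ + 1 + J.im with hPdef
  have hP0 : 0 ≤ P := by rw [hPdef]; linarith
  set G : ℝ := Cσ * Real.exp (-(3 / 20) * (L * ℓ)) * Real.exp (N * P + N ^ 2 * τ / 2) with hGdef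
  have hG0 : 0 ≤ G := by rw [hGdef]; positivity
  -- the exponential factor `n^{-σ} e^{(Re J - σ)²/τ} = e^{-(Re J) ℓ - L ℓ /4} ≤ e^{-0.15 L ℓ}`
  have hexpfac : (n : ℝ) ^ (-σ) * Real.exp ((J.re - σ) ^ 2 / τ) ≤ Real.exp (-(3 / 20) * (L * ℓ)) := by
    have hn0 : (0 : ℝ) < n := by exact_mod_cast hn
    rw [Real.rpow_def_of_pos hn0, ← hℓdef, ← Real.exp_add, Real.exp_le_exp]
    have e1 : (J.re - σ) ^ 2 / τ = L * ℓ / 4 := by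
      rw [hσdef, hLdef]; field_simp; ring
    rw [e1]
    have : -(J.re) * ℓ ≤ L / 10 * ℓ := by
      exact mul_le_mul_of_nonneg_right (by linarith [neg_abs_le J.re, (abs_le.1 hJre).1]) hℓ0
    have e2 : ℓ * -σ = -(J.re) * ℓ - L * ℓ / 2 := by rw [hσdef]; ring
    rw [e2]
    linarith [this]
  have hpt : ∀ v : ℝ, ‖D.dobnerI t n s (σ + v * I)‖ ≤ G * Real.exp (-((v - J.im) ^ 2 / (2 * τ))) := by
    intro v
    have h1 := D.norm_dobnerI_vertical_le t hn s hσ0 v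
    rw [← hJdef, ← hCσdef, ← hNdef] at h1
    have h2 : (σ + 1 + |v|) ^ N * Real.exp (-((J.im - v) ^ 2 / τ)) ≤
        Real.exp (N * P + N ^ 2 * τ / 2) * Real.exp (-((v - J.im) ^ 2 / (2 * τ))) := by
      have hv : |v| ≤ J.im + |v - J.im| := by
        calc |v| = |J.im + (v - J.im)| := by ring_nf
          _ ≤ |J.im| + |v - J.im| := abs_add_le _ _
          _ = J.im + |v - J.im| := by rw [abs_of_pos hJim1]
      have h3 : (σ + 1 + |v|) ^ N ≤ (P + |v - J.im|) ^ N := by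
        have : 0 ≤ σ + 1 + |v| := by positivity
        exact pow_le_pow_left₀ this (by rw [hPdef]; linarith) N
      have e : (J.im - v) ^ 2 = (v - J.im) ^ 2 := by ring
      rw [e]
      exact (mul_le_mul_of_nonneg_right h3 (Real.exp_pos _).le).trans
        (pow_mul_exp_neg_sq_le hP0 hτ N _)
    calc ‖D.dobnerI t n s (σ + v * I)‖
        ≤ Cσ * (σ + 1 + |v|) ^ N * (n : ℝ) ^ (-σ) *
            Real.exp ((J.re - σ) ^ 2 / τ) * Real.exp (-((J.im - v) ^ 2 / τ)) := h1
      _ = Cσ * ((n : ℝ) ^ (-σ) * Real.exp ((J.re - σ) ^ 2 / τ)) *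
            ((σ + 1 + |v|) ^ N * Real.exp (-((J.im - v) ^ 2 / τ))) := by ring
      _ ≤ Cσ * Real.exp (-(3 / 20) * (L * ℓ)) *
            (Real.exp (N * P + N ^ 2 * τ / 2) * Real.exp (-((v - J.im) ^ 2 / (2 * τ)))) := by
          gcongr
      _ = G * Real.exp (-((v - J.im) ^ 2 / (2 * τ))) := by rw [hGdef]; ring
  have hint : ‖∫ v : ℝ, D.dobnerI t n s (σ + v * I)‖ ≤ G * Real.sqrt (2 * Real.pi * τ) := by
    have h1 := norm_integral_le_of_norm_le ((integrable_exp_neg_sq_sub_div J.im hτ).const_mul G)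
      (Eventually.of_forall hpt)
    rwa [MeasureTheory.integral_const_mul, integral_exp_neg_sq_sub_div J.im hτ] at h1
  -- Step 5: `‖B‖ ≤ √2 G`
  have hB : ‖D.dobnerB t n s‖ ≤ (cα * D.Q ^ σ * (∏ i, Real.Gamma (D.omega i * σ + (D.mu i).re)) *
      Real.exp (N * P + N ^ 2 * τ / 2)) * Real.exp (-(3 / 20) * (L * ℓ)) := by
    rw [dobnerB, hshift, norm_mul, Complex.norm_real, Real.norm_eq_abs,
      abs_of_pos (by positivity)]
    have hc : 1 / Real.sqrt (Real.pi * τ) * (G * Real.sqrt (2 * Real.pi * τ)) = Real.sqrt 2 * G := by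
      have : Real.sqrt (2 * Real.pi * τ) = Real.sqrt 2 * Real.sqrt (Real.pi * τ) := by
        rw [← Real.sqrt_mul (by norm_num : (0:ℝ) ≤ 2)]; ring_nf
      rw [this]; field_simp
    calc 1 / Real.sqrt (Real.pi * τ) * ‖∫ v : ℝ, D.dobnerI t n s (σ + v * I)‖
        ≤ 1 / Real.sqrt (Real.pi * τ) * (G * Real.sqrt (2 * Real.pi * τ)) :=
          mul_le_mul_of_nonneg_left hint (by positivity)
      _ = Real.sqrt 2 * G := hc
      _ = _ := by rw [hGdef, hCσdef, hcαdef]; ring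
  -- Step 6: the absorption `√2 ‖α‖ Q^σ ∏Γ(ωᵢσ + Re μᵢ) e^{NP + N²τ/2} ≤ e^{L ℓ / 20}` (Lemma 7's role)
  -- (a) `Γ(ωᵢσ + Re μᵢ) ≤ R^R`, `R = cR L`
  set R : ℝ := cR * L with hRdef
  have hRL : L ≤ R := by rw [hRdef]; exact le_mul_of_one_le_left hLpos.le hcR1
  have hR1 : 1 ≤ R := hL1.trans hRL
  have hRpos : 0 < R := by linarith
  have hΓi : ∀ i, Real.Gamma (D.omega i * σ + (D.mu i).re) ≤ Real.exp (R * Real.log R) := by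
    intro i
    have hω := D.omega_pos i
    have hωi : 1 / D.omega i ≤ cω :=
      Finset.single_le_sum (f := fun j ↦ 1 / D.omega j) (fun j _ ↦ (one_div_pos.2 (D.omega_pos j)).le)
        (Finset.mem_univ i)
    have hωW : D.omega i ≤ W := D.omega_le_omegaSum i
    have hμM : (D.mu i).re ≤ Mμ :=
      Finset.single_le_sum (f := fun j ↦ (D.mu j).re) (fun j _ ↦ D.mu_re_nonneg j) (Finset.mem_univ i)
    have hu1 : 1 ≤ D.omega i * σ + (D.mu i).re := by
      have h1 : D.omega i * cω ≤ D.omega i * (2 * L / 5) :=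
        mul_le_mul_of_nonneg_left (by linarith) hω.le
      have h2 : 1 ≤ D.omega i * cω := by
        calc (1 : ℝ) = D.omega i * (1 / D.omega i) := by field_simp
          _ ≤ D.omega i * cω := mul_le_mul_of_nonneg_left hωi hω.le
      have h3 : D.omega i * (2 * L / 5) ≤ D.omega i * σ := mul_le_mul_of_nonneg_left hσ1 hω.le
      linarith [D.mu_re_nonneg i]
    have huR : D.omega i * σ + (D.mu i).re ≤ R := by
      have h1 : D.omega i * σ ≤ W * L := by
        calc D.omega i * σ ≤ D.omega i * L := mul_le_mul_of_nonneg_left hσL hω.le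
          _ ≤ W * L := mul_le_mul_of_nonneg_right hωW hLpos.le
      have h2 : (D.mu i).re ≤ Mμ * L := by
        calc (D.mu i).re ≤ Mμ := hμM
          _ = Mμ * 1 := (mul_one _).symm
          _ ≤ Mμ * L := mul_le_mul_of_nonneg_left hL1 hMμ0
      rw [hRdef, hcRdef]
      have hL0' : 0 ≤ L := hLpos.le
      linarith
    have hu0 : 0 ≤ D.omega i * σ + (D.mu i).re := by linarith
    calc Real.Gamma (D.omega i * σ + (D.mu i).re)
        ≤ (D.omega i * σ + (D.mu i).re) ^ (D.omega i * σ + (D.mu i).re) := Real.Gamma_le_rpow_self hu1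
      _ ≤ R ^ (D.omega i * σ + (D.mu i).re) := Real.rpow_le_rpow hu0 huR hu0
      _ ≤ R ^ R := Real.rpow_le_rpow_of_exponent_le hR1 huR
      _ = Real.exp (R * Real.log R) := by rw [Real.rpow_def_of_pos hRpos, mul_comm]
  have hprod : ∏ i, Real.Gamma (D.omega i * σ + (D.mu i).re) ≤ Real.exp (k * (R * Real.log R)) := by
    calc ∏ i, Real.Gamma (D.omega i * σ + (D.mu i).re)
        ≤ ∏ _i : Fin D.numGamma, Real.exp (R * Real.log R) :=
          Finset.prod_le_prod (fun i _ ↦ (Real.Gamma_pos_of_pos (by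
            have := mul_pos (D.omega_pos i) hσ0; linarith [D.mu_re_nonneg i])).le) fun i _ ↦ hΓi i
      _ = Real.exp (R * Real.log R) ^ k := by
          rw [Finset.prod_const, Finset.card_univ, Fintype.card_fin]
      _ = Real.exp (k * (R * Real.log R)) := by rw [← Real.exp_nat_mul]
  -- (b) `Q^σ ≤ e^{L lQ}`, `√2‖α‖ ≤ e^{cα}`
  have hQpos : 0 < D.Q := D.Q_pos
  have hQσ : D.Q ^ σ ≤ Real.exp (L * lQ) := by
    rw [Real.rpow_def_of_pos hQpos, Real.exp_le_exp]
    calc Real.log D.Q * σ ≤ |Real.log D.Q| * σ := mul_le_mul_of_nonneg_right (le_abs_self _) hσ0.le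
      _ ≤ |Real.log D.Q| * L := mul_le_mul_of_nonneg_left hσL (abs_nonneg _)
      _ = L * lQ := by rw [hlQdef, mul_comm]
  have hcαexp : cα ≤ Real.exp cα := by linarith [Real.add_one_le_exp cα]
  -- (c) the exponent is `≤ L²/(20τ) = L ℓ/20`
  have hRlog : R * Real.log R = cR * Real.log cR * L + cR * (L * Real.log L) := by
    rw [hRdef, Real.log_mul (by linarith) hLpos.ne']; ring
  have hPbd : (N : ℝ) * P ≤ N * (1 + 2 * τ * W) + 3 * N / 5 * L + N * L ^ (5 / 3 : ℝ) := by
    have hN0 : (0 : ℝ) ≤ N := Nat.cast_nonneg _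
    have hP' : P ≤ 3 * L / 5 + (1 + 2 * τ * W) + L ^ (5 / 3 : ℝ) := by rw [hPdef]; linarith
    calc (N : ℝ) * P ≤ N * (3 * L / 5 + (1 + 2 * τ * W) + L ^ (5 / 3 : ℝ)) :=
          mul_le_mul_of_nonneg_left hP' hN0
      _ = _ := by ring
  have hS : cα + L * lQ + k * (R * Real.log R) + (N * P + N ^ 2 * τ / 2) ≤ 1 / 20 * (L * ℓ) := by
    have e : L * ℓ = L ^ (2 : ℝ) / τ := by
      rw [hL2, hLdef]; field_simp
    rw [e, hRlog]
    have hτ100 : 0 < 100 * τ := by positivity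
    have hk0 : (0 : ℝ) ≤ k := Nat.cast_nonneg _
    -- each group is `≤ L²/(100 τ)`
    have i1 : cα + N * (1 + 2 * τ * W) + N ^ 2 * τ / 2 ≤ L ^ (2 : ℝ) / (100 * τ) := by
      rw [le_div_iff₀ hτ100]
      have : (cα + N * (1 + 2 * τ * W) + N ^ 2 * τ / 2) * (100 * τ) = 100 * τ * c₀ := by
        rw [hc₀def]; ring
      linarith
    have i2 : (lQ + 3 * N / 5 + k * cR * Real.log cR) * L ≤ L ^ (2 : ℝ) / (100 * τ) := by
      rw [le_div_iff₀ hτ100]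
      have : (lQ + 3 * N / 5 + k * cR * Real.log cR) * L * (100 * τ) = 100 * τ * c₁ * L := by
        rw [hc₁def]; ring
      linarith
    have i3 : k * cR * (L * Real.log L) ≤ L ^ (2 : ℝ) / (100 * τ) := by
      rw [le_div_iff₀ hτ100]
      linarith
    have i4 : N * L ^ (5 / 3 : ℝ) ≤ L ^ (2 : ℝ) / (100 * τ) := by
      rw [le_div_iff₀ hτ100]
      linarith
    have hsum : cα + L * lQ + k * (cR * Real.log cR * L + cR * (L * Real.log L)) +
        (N * P + N ^ 2 * τ / 2) ≤
        (cα + N * (1 + 2 * τ * W) + N ^ 2 * τ / 2) + (lQ + 3 * N / 5 + k * cR * Real.log cR) * L +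
          k * cR * (L * Real.log L) + N * L ^ (5 / 3 : ℝ) := by
      linarith [hPbd]
    have hX0 : 0 ≤ L ^ (2 : ℝ) / τ := by rw [hL2]; positivity
    have hX : L ^ (2 : ℝ) / (100 * τ) * 4 = 1 / 25 * (L ^ (2 : ℝ) / τ) := by
      field_simp; ring
    linarith
  have hfinal : cα * D.Q ^ σ * (∏ i, Real.Gamma (D.omega i * σ + (D.mu i).re)) *
      Real.exp (N * P + N ^ 2 * τ / 2) ≤ Real.exp (1 / 20 * (L * ℓ)) := by
    have hΓ0 : 0 ≤ ∏ i, Real.Gamma (D.omega i * σ + (D.mu i).re) :=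
      Finset.prod_nonneg fun i _ ↦ (Real.Gamma_pos_of_pos (by
        have := mul_pos (D.omega_pos i) hσ0; linarith [D.mu_re_nonneg i])).le
    calc cα * D.Q ^ σ * (∏ i, Real.Gamma (D.omega i * σ + (D.mu i).re)) *
          Real.exp (N * P + N ^ 2 * τ / 2)
        ≤ Real.exp cα * Real.exp (L * lQ) * Real.exp (k * (R * Real.log R)) *
          Real.exp (N * P + N ^ 2 * τ / 2) := by gcongr
      _ = Real.exp (cα + L * lQ + k * (R * Real.log R) + (N * P + N ^ 2 * τ / 2)) := by
          simp only [Real.exp_add]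
      _ ≤ Real.exp (1 / 20 * (L * ℓ)) := Real.exp_le_exp.2 hS
  calc ‖D.dobnerB t n s‖
      ≤ (cα * D.Q ^ σ * (∏ i, Real.Gamma (D.omega i * σ + (D.mu i).re)) *
          Real.exp (N * P + N ^ 2 * τ / 2)) * Real.exp (-(3 / 20) * (L * ℓ)) := hB
    _ ≤ Real.exp (1 / 20 * (L * ℓ)) * Real.exp (-(3 / 20) * (L * ℓ)) :=
        mul_le_mul_of_nonneg_right hfinal (Real.exp_pos _).le
    _ = 1 * Real.exp (-(|t| / 10) * Real.log n ^ 2) := by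
        rw [← Real.exp_add, one_mul]; congr 1; rw [hLdef, hℓdef]; ring

end ExtendedSelbergDatum

end Literature.NumberTheory.LFunctions

end
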